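import Summits.KontsevichZagierPeriods.KontsevichZagierPeriods.Theses.HurwitzMicroSectors
import Summits.KontsevichZagierPeriods.KontsevichZagierPeriods.Theorems.HurwitzMicroSectorsAperySectorThreeTwo
import Summits.KontsevichZagierPeriods.KontsevichZagierPeriods.Theorems.HurwitzMicroSectorsRigidityTwoSix
import Summits.KontsevichZagierPeriods.KontsevichZagierPeriods.Theorems.HurwitzMicroSectorsSectorTwoSix
import Literature.NumberTheory.Transcendental.KZKernelConjectureForms
import Literature.NumberTheory.Transcendental.KZProduct
import Literature.NumberTheory.Transcendental.LindemannWeierstrassProofs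
import Summits.KontsevichZagierPeriods.KontsevichZagierPeriods.Theorems.LogPrimitiveNL.Negative.DimZero

/-!
# Disproof of `HurwitzSectorComplement` (crux stmt-KontsevichZagierPeriods-14341, route HurwitzMicroSectors) — findings

Standing adversary (cdisprove), cycle 1 — refuter-cdisprove-stmt-KontsevichZagierPeriods-14341-0,
2026-08-16. 0 `sorry`. Everything below is kernel-checked.

The crux (auto-promoted from a support item the planner filed as "NOT CLAIMED"):
`HurwitzSectorComplement := SectorTwoSix → AperySectorThreeTwo → NormalFormPrinciple`.

## VERDICT SO FAR: no kill — and provably none short of a disproof of the summit, because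
## BOTH antecedents are theorems, so the crux IS the summit statement (`crux_iff_summit`).

* §1 BOTH ANTECEDENTS ARE THEOREMS NOW. `h2_holds : AperySectorThreeTwo` is the tree theorem
  `AperySectorThreeTwo_of` (item 3873); `h1_holds : SectorTwoSix` is the tree theorem `SectorTwoSix_of`
  (item 3870, landed during this cycle; our earlier 12-line glue over `reductionTwoSix_proof` +
  `rigidityTwoSix_proof` is attached as evidence on 3870).
* §2 CHARACTERISATION. `nfp_iff_summit : NormalFormPrinciple ↔ KontsevichZagierPeriods` (take
  `𝒩 = rational reps`; converse = the route's deciding theorem `closes`), hence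
  `crux_iff_nfp`, `crux_iff_summit : HurwitzSectorComplement ↔ KontsevichZagierPeriods`,
  `crux_iff_kernel : … ↔ KZKernelConjecture` (`ker eval = relations`), and
  `not_crux_iff : ¬ HurwitzSectorComplement ↔ ¬ KontsevichZagierPeriods`,
  `not_crux_iff_exists : ¬ crux ↔ ∃ c, eval c = 0 ∧ c ∉ relations`.
* §3 LOAD-BEARING ANALYSIS OF THE CRUX'S HYPOTHESES: both are IDLE (`crux_iff_withoutH1`,
  `crux_iff_withoutH2`, `crux_iff_withoutBoth`); every `_false_without_` theorem would literally be
  `¬ KontsevichZagierPeriods` (`not_withoutH1_iff`, …). Nothing to drop, nothing to weaken.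
* §4 THE ONLY WEAPON (template): `not_crux_of_separating_invariant` — an additive
  `J : FormalRep →+ A` killing the four move sets with `J c ≠ 0` for some `c ∈ ker eval`; conversely
  `exists_separating_of_not_crux`. Landed no-gos elsewhere in the tree apply verbatim since the crux is
  the summit: `FormalRep ⧸ relations` is divisible and torsion-free
  (`MultiplicationAccessible.Negative.mem_relations_of_nsmul_mem_relations`,
  `sub_nsmul_scale_inv_mem_relations`) so every ℤ-valued / finite-valued move-invariant vanishes; the
  known sub-calculus invariants (`KZ.coeffSum`, `KZ.restrictedEval`, `SectorTwoSix.Negative.posMass`,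
  dimension-filtered evaluation) each die on one of the four moves.
* §5 NEW NEGATIVE KNOWLEDGE — THE RUNG TABLE IS INFINITE BY NECESSITY (refuted strengthenings of
  `NormalFormPrinciple`, the conclusion of the crux): `not_reduction_finiteSpan` — NO family `𝒩` whose
  values lie in a finite-dimensional `ℚ`-subspace of `ℝ` can satisfy the REDUCTION half (witness: the
  rational representations `piPow k = [disc]^k × [ℝ⁰,1]` of value `π^k`, soundness, and the
  transcendence of `π` — tree theorem `transcendental_pi_holds` — via `isIntegral_of_smul_mem_submodule`).
  Corollaries: `not_normalFormPrincipleFiniteSpan`; `reduction_values_escape` (any reducing `𝒩` has,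
  for every finite `S`, a member valued outside `span_ℚ S`); and for THIS route
  `not_reduction_to_closed_rungs`: the union of the two CLOSED rungs — the `(2,6)` normal forms
  `a + b/(1−xy) + c/(1+xy+x²y²)` (values `a + bπ²/6 + cL(2,χ₋₃)`, tree `value_of_normalForm`) and the
  whole `(3,2)` sector `P(xyz)/(1−(xyz)²)` (values in `ℚ + ℚζ(3)`, tree stubs of `AperySectorThreeTwo_of`)
  — is NOT a reduction target, and neither is its enlargement by ANY finite list of further constants
  (`not_reduction_to_closed_rungs_add_finite`: Catalan's `G`, `π⁴`, `L(4,χ₋₃)`, `ζ(3)π³√3`, …). So no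
  finite splice of rungs of the route's kind ever reaches the complement: a witness `𝒩` for
  `NormalFormPrinciple` needs values of infinite `ℚ`-dimension, i.e. infinitely many independent
  rigidity inputs.
* §5c BOUNDED DIMENSION, `d = 0` (refuted strengthening 2): `isAlgebraic_value_dimZero` — values of
  dimension-`0` representations are real algebraic numbers (reusing the landed sibling lemma "a
  `ℚ`-semialgebraic point of `ℝ¹` is algebraic", `GammaHodgeSectorNegative.isAlgebraic_of_isSemialgebraic_singleton`
  / `LogPrimitiveNL.Negative.isAlgebraic_of_isSemialgebraicFunOn_fin_zero`), hence `not_reduction_dimZero`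
  (`[disc,1]` has value `π`) and `not_reduction_of_subsingleton_dims`. `d ≥ 1`: OPEN (§8).
* LANDED (Theorems/HurwitzSectorComplement/Negative/): `Core.lean` (p82128, §§0–4, 6), `FiniteRungTable.lean`
  (p82895, §5–5b), `DimZero.lean` (§5c, proposal pending at the time of writing).
* §6 SANITY: each half of `NormalFormPrinciple` alone is trivially satisfiable (`rigid_empty`,
  `reducing_rational`); all content is in the conjunction.
* §7 Targets (lead's stuck stubs): none yet (`targets = []`).
* §8 Open questions / near-misses: docstring at the end (bounded-dimension normal forms; no candidate
  separating invariant survives the artifact hunt recorded in NOTES.md).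

WHY IT RESISTS (for provers and planners). Modulo two theorems the item is `KontsevichZagierPeriods`
itself (`crux_iff_summit`). A disproof = an element of `ker KZ.eval` outside `KZ.relations` certified by a
new additive invariant of the four-move calculus; the artifact hunt on the formal calculus (dimension 0,
null/empty domains, off-domain values, unbounded domains, the semialgebraic-primitive restriction of
rule (3), `HasFDerivWithinAt` on thin sets, integer coefficients / torsion) yields none — see NOTES.md.
A proof = Conjecture 1 of Kontsevich–Zagier for the H21 calculus. Do not staff.

References: M. Kontsevich, D. Zagier, *Periods* (2001), §1.2 Conjecture 1; F. Calegari, V. Dimitrov,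
Y. Tang, arXiv:2408.15403 (2024), Thm 1; F. Lindemann (1882) (transcendence of `π`, tree:
`LindemannWeierstrassProofs`).
-/

noncomputable section

set_option linter.dupNamespace false

namespace Summit.KontsevichZagierPeriods.KontsevichZagierPeriods.Cruxes.HurwitzSectorComplement.Disproof

open Set MeasureTheory Polynomial
open Literature.NumberTheory.Transcendental
open Literature.NumberTheory.Transcendental.KZ
open Literature.ModelTheory.ExponentialFields (isSemialgebraic_univ IsSemialgebraic)
open Summit.KontsevichZagierPeriods.KontsevichZagierPeriods.Theses.HurwitzMicroSectors

/-! ## §0 Read-back -/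

/-- The crux unfolds definitionally to the implication chain. [folklore] -/
theorem crux_iff :
    HurwitzSectorComplement ↔ (SectorTwoSix → AperySectorThreeTwo → NormalFormPrinciple) :=
  Iff.rfl

/-- The summit IS the kernel form `ker eval = relations` (tree theorem
`kzKernelConjecture_iff_isRational`). [folklore] -/
theorem summit_iff_kernel : KontsevichZagierPeriods ↔ KZKernelConjecture :=
  kzKernelConjecture_iff_isRational.symm

/-! ## §1 Both antecedents are theorems -/

/-- `H₂ = AperySectorThreeTwo` is a tree theorem (item 3873, closed). [folklore] -/
theorem h2_holds : AperySectorThreeTwo :=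
  Summit.KontsevichZagierPeriods.Theorems.AperySectorThreeTwo.AperySectorThreeTwo_of

/-- **`H₁ = SectorTwoSix` holds**: tree theorem `SectorTwoSix_of` (item 3870, closed 2026-08-16 during
this cycle, line `jacobian-monomial-absorption`). (Before it landed this file carried a 12-line glue proof
over the closed items `reductionTwoSix_proof` (3871) + `rigidityTwoSix_proof` (3874) + one
integrand-additivity move `KZ.of_sub_of_mem_relations_of_eqOn`; kept in the folder as
`SectorTwoSixGlue.lean`, attached as evidence on 3870.) [cite: CalegariDimitrovTang2024, Thm 1] -/
theorem h1_holds : SectorTwoSix :=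
  Summit.KontsevichZagierPeriods.Theorems.HurwitzMicroSectorsSectorTwoSix.SectorTwoSix_of

/-! ## §2 Characterisation: the crux is the summit -/

/-- The summit gives the normal-form principle with `𝒩 = rational representations`. [folklore] -/
theorem nfp_of_summit (h : KontsevichZagierPeriods) : NormalFormPrinciple :=
  ⟨fun _ => {N | N.IsRational}, fun _ _ N N' hN hN' hv => h N N' hN hN' hv,
    fun n r hr => ⟨n, r, hr, Equivalent.refl r⟩⟩

/-- The normal-form principle gives the summit (the route's deciding theorem `closes`). [folklore] -/
theorem summit_of_nfp (h : NormalFormPrinciple) : KontsevichZagierPeriods := closes h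

/-- **The route's target restates the summit.** [folklore] -/
theorem nfp_iff_summit : NormalFormPrinciple ↔ KontsevichZagierPeriods :=
  ⟨summit_of_nfp, nfp_of_summit⟩

/-- Both antecedents being theorems, the crux is its own conclusion. [folklore] -/
theorem crux_iff_nfp : HurwitzSectorComplement ↔ NormalFormPrinciple :=
  ⟨fun h => h h1_holds h2_holds, fun h _ _ => h⟩

/-- **The crux IS the summit statement** (Conjecture 1 of Kontsevich–Zagier over `KZ.relations`). [folklore] -/
theorem crux_iff_summit : HurwitzSectorComplement ↔ KontsevichZagierPeriods :=
  crux_iff_nfp.trans nfp_iff_summit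

/-- … equivalently the kernel form `ker KZ.eval = KZ.relations`. [folklore] -/
theorem crux_iff_kernel : HurwitzSectorComplement ↔ KZKernelConjecture :=
  crux_iff_summit.trans summit_iff_kernel

/-- Hypothesis-form of `crux_iff_summit` for consumers who do not want this file's proof of `H₁`. [folklore] -/
theorem crux_iff_summit_of (h1 : SectorTwoSix) : HurwitzSectorComplement ↔ KontsevichZagierPeriods :=
  ⟨fun h => summit_of_nfp (h h1 h2_holds), fun h _ _ => nfp_of_summit h⟩

/-- Without using `h1_holds`: the crux is exactly "`SectorTwoSix` is summit-strength". [folklore] -/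
theorem crux_iff_imp : HurwitzSectorComplement ↔ (SectorTwoSix → KontsevichZagierPeriods) :=
  ⟨fun h h1 => summit_of_nfp (h h1 h2_holds), fun h h1 _ => nfp_of_summit (h h1)⟩

/-- **Anatomy of a refutation**: `¬ crux` is precisely a disproof of the summit. [folklore] -/
theorem not_crux_iff : ¬ HurwitzSectorComplement ↔ ¬ KontsevichZagierPeriods :=
  not_congr crux_iff_summit

/-- … i.e. an element of `ker eval` outside `relations`. [folklore] -/
theorem not_crux_iff_exists :
    ¬ HurwitzSectorComplement ↔ ∃ c : FormalRep, eval c = 0 ∧ c ∉ relations := by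
  rw [not_congr crux_iff_kernel]
  unfold KZKernelConjecture
  push Not
  rfl

/-- The summit proves the crux (discard the antecedents). [folklore] -/
theorem crux_of_summit (h : KontsevichZagierPeriods) : HurwitzSectorComplement :=
  crux_iff_summit.mpr h

/-! ## §3 Load-bearing analysis of the crux's hypotheses: both are idle -/

/-- The crux with `H₁ = SectorTwoSix` dropped. [folklore] -/
def WithoutH1 : Prop := AperySectorThreeTwo → NormalFormPrinciple

/-- The crux with `H₂ = AperySectorThreeTwo` dropped. [folklore] -/
def WithoutH2 : Prop := SectorTwoSix → NormalFormPrinciple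

/-- The crux with both antecedents dropped: the route's target. [folklore] -/
def WithoutBoth : Prop := NormalFormPrinciple

/-- Dropping `H₁` changes nothing. [folklore] -/
theorem crux_iff_withoutH1 : HurwitzSectorComplement ↔ WithoutH1 :=
  ⟨fun h h2 => h h1_holds h2, fun h _ h2 => h h2⟩

/-- Dropping `H₂` changes nothing. [folklore] -/
theorem crux_iff_withoutH2 : HurwitzSectorComplement ↔ WithoutH2 :=
  ⟨fun h h1 => h h1 h2_holds, fun h h1 _ => h h1⟩

/-- Dropping both changes nothing. [folklore] -/
theorem crux_iff_withoutBoth : HurwitzSectorComplement ↔ WithoutBoth := crux_iff_nfp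

/-- No `_false_without_H₁` theorem exists short of `¬ summit`. [folklore] -/
theorem not_withoutH1_iff : ¬ WithoutH1 ↔ ¬ KontsevichZagierPeriods :=
  (not_congr crux_iff_withoutH1).symm.trans not_crux_iff

/-- No `_false_without_H₂` theorem exists short of `¬ summit`. [folklore] -/
theorem not_withoutH2_iff : ¬ WithoutH2 ↔ ¬ KontsevichZagierPeriods :=
  (not_congr crux_iff_withoutH2).symm.trans not_crux_iff

/-- No `_false_without_both` theorem exists short of `¬ summit`. [folklore] -/
theorem not_withoutBoth_iff : ¬ WithoutBoth ↔ ¬ KontsevichZagierPeriods :=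
  (not_congr crux_iff_withoutBoth).symm.trans not_crux_iff

/-! ## §4 The only weapon: a separating additive invariant (template) -/

/-- TEMPLATE of a refutation of the crux (= of the summit): an additive invariant `J` of `FormalRep`
vanishing on the four move sets and a formal combination of value `0` on which `J` does not vanish.
Soundness (`relations_le_ker_eval_holds`) says `eval` is such a `J` except for the last clause; no other
is known. [folklore] -/
theorem not_crux_of_separating_invariant {A : Type*} [AddCommGroup A] (J : FormalRep →+ A)
    (hJ : ∀ x ∈ domainAddRel ∪ integrandAddRel ∪ changeOfVariablesRel ∪ newtonLeibnizRel, J x = 0)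
    (c : FormalRep) (hc : eval c = 0) (hJc : J c ≠ 0) : ¬ HurwitzSectorComplement := fun h => by
  have hker : relations ≤ J.ker := (AddSubgroup.closure_le _).mpr fun x hx => hJ x hx
  exact hJc (hker (crux_iff_kernel.mp h c hc))

/-- Conversely every refutation of the crux IS such a pair: `J` the quotient map by `relations`,
`c` the non-relation of value `0`. [folklore] -/
theorem exists_separating_of_not_crux (h : ¬ HurwitzSectorComplement) :
    ∃ c : FormalRep, eval c = 0 ∧ c ∉ relations :=
  not_crux_iff_exists.mp h

/-! ## §5 NEW: the rung table is infinite by necessity — refuted strengthenings of `NormalFormPrinciple`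

The route closes Conjecture 1 one `(weight, level)` rung at a time, each rung being a family of normal
forms whose values span a finite-dimensional `ℚ`-space (`(2,6)`: `ℚ + ℚπ² + ℚL(2,χ₋₃)`; `(3,2)`:
`ℚ + ℚζ(3)`; `(2,4)`: `ℚ + ℚπ² + ℚG`; …), closed by one linear-independence theorem each. The crux is the
splice point "all remaining rungs". We prove that NO FINITE splice suffices: a family `𝒩` to which every
rational representation reduces must take values of infinite `ℚ`-dimension. Witness: the tower
`π^k`, realised by the rational representations `piPow k`, and Lindemann's theorem. -/

/-- The constant representation `[ℝ⁰, 1]` (value `1`, KZ-literal shape). [folklore] -/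
def oneRep0 : IntegralRep 0 :=
  IntegralRep.ofRational univ 1 1 isSemialgebraic_univ (fun _ _ => by simp) (by simp)

/-- The `π`-power tower: `piPow 0 = [ℝ⁰, 1]`, `piPow (k+1) = [disc] × piPow k` (tree: `KZ.piRep`,
`IntegralRep.prod`), a representation of dimension `2k` (as `2 + (2 + ⋯ + 0)`).
[cite: KontsevichZagier2001, §1.1 eq. (1)] -/
def piPow : ℕ → Σ n, IntegralRep n
  | 0 => ⟨0, oneRep0⟩
  | k + 1 => ⟨2 + (piPow k).1, piRep.prod (piPow k).2⟩

/-- The integrand of `piPow k` is the constant `1`. [folklore] -/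
theorem piPow_integrand (k : ℕ) : ∀ z, (piPow k).2.integrand z = 1 := by
  induction k with
  | zero => intro z; simp [piPow, oneRep0]
  | succ k ih =>
    intro z
    simp [piPow, IntegralRep.prodFun, ih]

/-- `piPow k` has KZ's literal (rational) shape: integrand `1 / 1`. [folklore] -/
theorem piPow_isRational (k : ℕ) : (piPow k).2.IsRational :=
  ⟨1, 1, fun _ _ => by simp, fun z _ => by simp [piPow_integrand]⟩

/-- **`value (piPow k) = π ^ k`** (Fubini for the factor `[disc]`, tree `value_piRep_prod`, and the
area of the unit disc, tree `piRep_value`). [cite: KontsevichZagier2001, §1.1 eq. (1)] -/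
theorem piPow_value (k : ℕ) : (piPow k).2.value = Real.pi ^ k := by
  induction k with
  | zero =>
    simp only [piPow, oneRep0, IntegralRep.value_ofRational, pow_zero]
    simp [MeasureTheory.Measure.real, MeasureTheory.volume_pi]
  | succ k ih =>
    show (piRep.prod (piPow k).2).value = _
    rw [IntegralRep.value_piRep_prod, ih, pow_succ, mul_comm]

/-- The powers of `π` do not all lie in one finite-dimensional `ℚ`-subspace of `ℝ` (else `π` would be
integral over `ℚ` by the determinant trick `isIntegral_of_smul_mem_submodule`, contradicting
Lindemann). [cite: Lindemann1882, via BakerTNT1975 Ch. 1 Theorem 1.3, p. 5] -/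
theorem not_forall_pi_pow_mem_span {S : Set ℝ} (hS : S.Finite)
    (hpow : ∀ k : ℕ, Real.pi ^ k ∈ Submodule.span ℚ S) : False := by
  set V : Submodule ℚ ℝ := Submodule.span ℚ S with hV
  haveI : FiniteDimensional ℚ V := FiniteDimensional.span_of_finite ℚ hS
  set W : Submodule ℚ ℝ := Submodule.span ℚ (Set.range fun k : ℕ => Real.pi ^ k) with hW
  have hWV : W ≤ V := Submodule.span_le.mpr (by rintro _ ⟨k, rfl⟩; exact hpow k)
  haveI : FiniteDimensional ℚ W := Submodule.finiteDimensional_of_le hWV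
  have hfg : W.FG := Module.Finite.iff_fg.mp inferInstance
  have hW0 : W ≠ ⊥ := by
    intro h
    have h1 : (Real.pi ^ 0 : ℝ) ∈ W := Submodule.subset_span ⟨0, rfl⟩
    rw [h, Submodule.mem_bot, pow_zero] at h1
    exact one_ne_zero h1
  have hsmul : ∀ w ∈ W, Real.pi • w ∈ W := by
    intro w hw
    have : W ≤ W.comap (LinearMap.mulLeft ℚ Real.pi) := by
      refine Submodule.span_le.mpr ?_
      rintro _ ⟨k, rfl⟩
      show Real.pi ^ k ∈ W.comap (LinearMap.mulLeft ℚ Real.pi)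
      rw [Submodule.mem_comap, LinearMap.mulLeft_apply, ← pow_succ']
      exact Submodule.subset_span ⟨k + 1, rfl⟩
    simpa using this hw
  have hint : IsIntegral ℚ Real.pi := isIntegral_of_smul_mem_submodule W hW0 hfg Real.pi hsmul
  exact transcendental_pi_holds hint.isAlgebraic

/-- **No reduction to a family with finite-dimensional value span.** If the values of the members of
`𝒩` lie in `span_ℚ S` for a finite `S ⊆ ℝ`, then NOT every rational representation is KZ-equivalent to
a member of `𝒩`: the `piPow k` are rational with values `π^k` (soundness transports values along
`Equivalent`), and these escape every finite-dimensional subspace. [folklore] -/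
theorem not_reduction_finiteSpan (𝒩 : (n : ℕ) → Set (IntegralRep n)) {S : Set ℝ} (hS : S.Finite)
    (hval : ∀ n (N : IntegralRep n), N ∈ 𝒩 n → N.value ∈ Submodule.span ℚ S)
    (hred : ∀ (n : ℕ) (r : IntegralRep n), r.IsRational →
      ∃ (m : ℕ) (N : IntegralRep m), N ∈ 𝒩 m ∧ Equivalent r N) : False := by
  refine not_forall_pi_pow_mem_span hS fun k => ?_
  obtain ⟨m, N, hN, hrN⟩ := hred _ (piPow k).2 (piPow_isRational k)
  rw [← piPow_value k, Equivalent.value_eq_holds hrN]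
  exact hval m N hN

/-- Positive phrasing: a reducing family takes, for every finite `S`, a value outside `span_ℚ S` —
its values have infinite `ℚ`-dimension, so rigidity on it needs infinitely many independent
linear-independence inputs ("the rung table is open-ended" is a theorem, not a design choice). [folklore] -/
theorem reduction_values_escape (𝒩 : (n : ℕ) → Set (IntegralRep n))
    (hred : ∀ (n : ℕ) (r : IntegralRep n), r.IsRational →
      ∃ (m : ℕ) (N : IntegralRep m), N ∈ 𝒩 m ∧ Equivalent r N)
    {S : Set ℝ} (hS : S.Finite) : ∃ (n : ℕ) (N : IntegralRep n), N ∈ 𝒩 n ∧ N.value ∉ Submodule.span ℚ S := by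
  by_contra h
  push Not at h
  exact not_reduction_finiteSpan 𝒩 hS h hred

/-- STRENGTHENING 1 of the crux's conclusion: `NormalFormPrinciple` with a normal-form family of
finite-dimensional value span. [folklore] -/
def NormalFormPrincipleFiniteSpan : Prop :=
  ∃ (𝒩 : (n : ℕ) → Set (IntegralRep n)) (S : Set ℝ), S.Finite ∧
    (∀ n (N : IntegralRep n), N ∈ 𝒩 n → N.value ∈ Submodule.span ℚ S) ∧
    (∀ (n m : ℕ) (N : IntegralRep n) (N' : IntegralRep m), N ∈ 𝒩 n → N' ∈ 𝒩 m →
      N.value = N'.value → Equivalent N N') ∧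
    (∀ (n : ℕ) (r : IntegralRep n), r.IsRational → ∃ (m : ℕ) (N : IntegralRep m), N ∈ 𝒩 m ∧ Equivalent r N)

/-- … is FALSE (unconditionally; the rigidity clause is not even used). [folklore] -/
theorem not_normalFormPrincipleFiniteSpan : ¬ NormalFormPrincipleFiniteSpan :=
  fun ⟨𝒩, _, hS, hval, _, hred⟩ => not_reduction_finiteSpan 𝒩 hS hval hred

/-- Hence the crux with this strengthened conclusion is false — as a STRENGTHENING, not a refutation of
the item (its antecedents are theorems). [folklore] -/
theorem not_cruxFiniteSpan : ¬ (SectorTwoSix → AperySectorThreeTwo → NormalFormPrincipleFiniteSpan) :=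
  fun h => not_normalFormPrincipleFiniteSpan (h h1_holds h2_holds)

/-! ### §5b The route's two closed rungs, concretely -/

/-- The `(2,6)` normal forms of the route (`ReductionTwoSix` / `RigidityTwoSix`): representations on the
open box `(0,1)²` with integrand `a + b/(1−xy) + c/(1+xy+x²y²)` there, `a b c ∈ ℚ`. [cite: CalegariDimitrovTang2024, Cor. 2] -/
def TwoSixNormalForms : Set (IntegralRep 2) :=
  {N | ∃ a b c : ℚ, N.domain = {x | ∀ i, x i ∈ Set.Ioo (0:ℝ) 1} ∧
    EqOn N.integrand (fun x => (a : ℝ) + b / (1 - x 0 * x 1) + c / (1 + x 0 * x 1 + (x 0 * x 1) ^ 2))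
      N.domain}

/-- The whole `(3,2)` sector of `AperySectorThreeTwo`: representations on the open box `(0,1)³` with
integrand `P(xyz)/(1 − (xyz)²)` there, `P ∈ ℚ[t]`. [cite: Apery1979] -/
def ThreeTwoSector : Set (IntegralRep 3) :=
  {N | ∃ P : ℚ[X], N.domain = {x | ∀ i, x i ∈ Set.Ioo (0:ℝ) 1} ∧
    EqOn N.integrand (fun x => Polynomial.aeval (x 0 * x 1 * x 2) P / (1 - (x 0 * x 1 * x 2) ^ 2))
      N.domain}

/-- `q • x = q * x` for the `ℚ`-module structure of `ℝ`. [folklore] -/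
theorem ratCast_mul_eq_smul (q : ℚ) (x : ℝ) : (q : ℝ) * x = q • x := (Rat.smul_def q x).symm

/-- Values of `(2,6)` normal forms lie in `span_ℚ {1, π², L(2,χ₋₃)}` (tree `value_of_normalForm`:
value `= a + b·π²/6 + c·L(2,χ₋₃)`). [cite: CalegariDimitrovTang2024, Cor. 2] -/
theorem value_mem_span_of_mem_twoSix {N : IntegralRep 2} (hN : N ∈ TwoSixNormalForms) :
    N.value ∈ Submodule.span ℚ ({1, Real.pi ^ 2, L2chi3} : Set ℝ) := by
  obtain ⟨a, b, c, hd, hi⟩ := hN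
  rw [Summit.KontsevichZagierPeriods.Theorems.HurwitzMicroSectorsRigidityTwoSix.value_of_normalForm
    a b c N hd hi]
  have h1 : (1 : ℝ) ∈ Submodule.span ℚ ({1, Real.pi ^ 2, L2chi3} : Set ℝ) :=
    Submodule.subset_span (by simp)
  have h2 : Real.pi ^ 2 ∈ Submodule.span ℚ ({1, Real.pi ^ 2, L2chi3} : Set ℝ) :=
    Submodule.subset_span (by simp)
  have h3 : L2chi3 ∈ Submodule.span ℚ ({1, Real.pi ^ 2, L2chi3} : Set ℝ) :=
    Submodule.subset_span (by simp)
  refine Submodule.add_mem _ (Submodule.add_mem _ ?_ ?_) ?_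
  · have : ((a : ℚ) : ℝ) = a • (1 : ℝ) := by rw [← ratCast_mul_eq_smul, mul_one]
    rw [this]; exact Submodule.smul_mem _ _ h1
  · have : ((b : ℚ) : ℝ) * (Real.pi ^ 2 / 6) = (b / 6 : ℚ) • Real.pi ^ 2 := by
      rw [← ratCast_mul_eq_smul]; push_cast; ring
    rw [this]; exact Submodule.smul_mem _ _ h2
  · rw [ratCast_mul_eq_smul]; exact Submodule.smul_mem _ _ h3

/-- Values of the `(3,2)` sector lie in `span_ℚ {1, ζ(3)}`: by the tree's reduction stubs every member is
KZ-equivalent to a normal form `a(1−t²) + b·t` of value `a + b·ζ(3)/8` (`value_normalForm`), and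
soundness transports the value. [cite: Apery1979] -/
theorem value_mem_span_of_mem_threeTwo {N : IntegralRep 3} (hN : N ∈ ThreeTwoSector) :
    N.value ∈ Submodule.span ℚ ({1, zetaValue 3} : Set ℝ) := by
  obtain ⟨P, hd, hi⟩ := hN
  have e1 := Summit.KontsevichZagierPeriods.Theorems.AperySectorThreeTwo.of_sub_of_sectorRep_mem hd hi
  obtain ⟨a, b, e2⟩ :=
    Summit.KontsevichZagierPeriods.Theorems.AperySectorThreeTwo.stub_normalFormReduction
      Summit.KontsevichZagierPeriods.Theorems.AperySectorThreeTwo.stub_monomialFlatten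
      Summit.KontsevichZagierPeriods.Theorems.AperySectorThreeTwo.stub_polarDistribution P
  rw [Equivalent.value_eq_holds e1, Equivalent.value_eq_holds e2,
    Summit.KontsevichZagierPeriods.Theorems.AperySectorThreeTwo.value_normalForm]
  have h1 : (1 : ℝ) ∈ Submodule.span ℚ ({1, zetaValue 3} : Set ℝ) := Submodule.subset_span (by simp)
  have h3 : zetaValue 3 ∈ Submodule.span ℚ ({1, zetaValue 3} : Set ℝ) := Submodule.subset_span (by simp)
  refine Submodule.add_mem _ ?_ ?_
  · have : ((a : ℚ) : ℝ) = a • (1 : ℝ) := by rw [← ratCast_mul_eq_smul, mul_one]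
    rw [this]; exact Submodule.smul_mem _ _ h1
  · have : ((b : ℚ) : ℝ) * (1 / 8 * zetaValue 3) = (b / 8 : ℚ) • zetaValue 3 := by
      rw [← ratCast_mul_eq_smul]; push_cast; ring
    rw [this]; exact Submodule.smul_mem _ _ h3

/-- The union of the two closed rungs, as a candidate normal-form family (empty in other dimensions). [folklore] -/
def closedRungs : (n : ℕ) → Set (IntegralRep n)
  | 2 => TwoSixNormalForms
  | 3 => ThreeTwoSector
  | _ => ∅

/-- Every member of the closed rungs has value in `span_ℚ {1, π², L(2,χ₋₃), ζ(3)}`. [folklore] -/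
theorem value_mem_span_of_mem_closedRungs {n : ℕ} {N : IntegralRep n} (hN : N ∈ closedRungs n) :
    N.value ∈ Submodule.span ℚ ({1, Real.pi ^ 2, L2chi3, zetaValue 3} : Set ℝ) := by
  match n, N, hN with
  | 0, _, hN => exact absurd hN (Set.notMem_empty _)
  | 1, _, hN => exact absurd hN (Set.notMem_empty _)
  | 2, N, hN =>
    refine Submodule.span_mono ?_ (value_mem_span_of_mem_twoSix hN)
    intro x hx
    simp only [Set.mem_insert_iff, Set.mem_singleton_iff] at hx ⊢
    tauto
  | 3, N, hN =>
    refine Submodule.span_mono ?_ (value_mem_span_of_mem_threeTwo hN)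
    intro x hx
    simp only [Set.mem_insert_iff, Set.mem_singleton_iff] at hx ⊢
    tauto
  | n + 4, _, hN => exact absurd hN (Set.notMem_empty _)

/-- **The two closed rungs are not a reduction target**: some rational representation is
KZ-equivalent to NO `(2,6)` normal form and to NO member of the `(3,2)` sector. (No transcendence
statement about `L(2,χ₋₃)` or `ζ(3)` versus `π` is needed — the `π`-tower alone overflows any
4-dimensional span.) [folklore] -/
theorem not_reduction_to_closed_rungs :
    ¬ ∀ (n : ℕ) (r : IntegralRep n), r.IsRational →
      ∃ (m : ℕ) (N : IntegralRep m), N ∈ closedRungs m ∧ Equivalent r N :=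
  fun hred => not_reduction_finiteSpan closedRungs
    (((Set.finite_singleton _).insert _).insert _ |>.insert _)
    (fun _ _ hN => value_mem_span_of_mem_closedRungs hN) hred

/-- … nor is ANY finite enlargement of them: adjoin finitely many further rungs whose values lie in the
span of a finite list `T` of constants (Catalan's `G` for `(2,4)`, `π⁴, L(4,χ₋₃)` for `(4,6)`,
`ζ(3), π³√3` for `(3,3)`, …) — reduction still fails. [folklore] -/
theorem not_reduction_to_closed_rungs_add_finite (ℳ : (n : ℕ) → Set (IntegralRep n)) {T : Set ℝ}
    (hT : T.Finite) (hℳ : ∀ n (N : IntegralRep n), N ∈ ℳ n → N.value ∈ Submodule.span ℚ T) :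
    ¬ ∀ (n : ℕ) (r : IntegralRep n), r.IsRational →
      ∃ (m : ℕ) (N : IntegralRep m), N ∈ closedRungs m ∪ ℳ m ∧ Equivalent r N := by
  intro hred
  refine not_reduction_finiteSpan (fun m => closedRungs m ∪ ℳ m)
    (S := ({1, Real.pi ^ 2, L2chi3, zetaValue 3} : Set ℝ) ∪ T)
    ((((Set.finite_singleton _).insert _).insert _ |>.insert _).union hT) ?_ hred
  rintro n N (hN | hN)
  · exact Submodule.span_mono Set.subset_union_left (value_mem_span_of_mem_closedRungs hN)
  · exact Submodule.span_mono Set.subset_union_right (hℳ n N hN)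


/-! ### §5c Bounded dimension: dimension-0 normal forms never suffice (values of `IntegralRep 0` are algebraic)

The fact "a `ℚ`-semialgebraic point of `ℝ¹` is algebraic" was ALREADY LANDED by sibling disprovers
(`GammaHodgeSectorNegative.isAlgebraic_of_isSemialgebraic_singleton`, and over the point
`LiouvilleUnfolding.LogPrimitiveNL.Negative.isAlgebraic_of_isSemialgebraicFunOn_fin_zero`); we REUSE it
(our own self-contained tameness-induction proof, `DimZero.lean` in the session folder, is not landed —
near-duplicate). -/

/-- **Values of dimension-`0` integral representations are real algebraic numbers** (the value is
`f (pt)` or `0`, and a `ℚ`-semialgebraic function over the point takes an algebraic value). The constants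
of the calculus are exactly `ℚ̄ ∩ ℝ` (converse: `KZPeriodsProofs`). [cite: KontsevichZagier2001, §1.1] -/
theorem isAlgebraic_value_dimZero (r : IntegralRep 0) : IsAlgebraic ℚ r.value := by
  rcases Set.eq_empty_or_nonempty r.domain with hd | hd
  · have : r.value = 0 := by rw [IntegralRep.value, hd]; simp
    rw [this]; exact isAlgebraic_zero
  have hdu : r.domain = univ := by
    obtain ⟨x, hx⟩ := hd
    exact eq_univ_of_forall fun y => by rwa [Subsingleton.elim y x]
  have hval : r.value = r.integrand default := by
    rw [IntegralRep.value, hdu, Measure.restrict_univ, MeasureTheory.volume_pi,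
      Measure.pi_of_empty (fun _ : Fin 0 => (volume : Measure ℝ)) default, integral_dirac]
  rw [hval]
  exact Summit.KontsevichZagierPeriods.LiouvilleUnfolding.LogPrimitiveNL.Negative.isAlgebraic_of_isSemialgebraicFunOn_fin_zero
    r.isSemialgebraicFunOn_integrand (by rw [hdu]; exact mem_univ _)

/-- **STRENGTHENING 2 (bounded dimension, `d = 0`) refuted**: no normal-form family concentrated in
dimension `0` is a reduction target — `[disc, 1]` has the transcendental value `π` (Lindemann), while
dimension-`0` values are algebraic and soundness transports values. (For `d ≥ 1` the question is OPEN: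
dimension-`1` values include the 1-periods of curves; we know no period provably outside them in the
tree.) [cite: Lindemann1882, via BakerTNT1975 Ch. 1 Theorem 1.3, p. 5] -/
theorem not_reduction_dimZero (𝒩 : Set (IntegralRep 0)) :
    ¬ ∀ (n : ℕ) (r : IntegralRep n), r.IsRational → ∃ N : IntegralRep 0, N ∈ 𝒩 ∧ Equivalent r N := by
  intro h
  obtain ⟨N, -, hN⟩ := h 2 piRep ⟨1, 1, fun _ _ => by simp, fun z _ => by simp⟩
  have hv : Real.pi = N.value := by rw [← piRep_value]; exact Equivalent.value_eq_holds hN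
  exact transcendental_pi_holds (hv ▸ isAlgebraic_value_dimZero N)

/-- The same for families indexed by all dimensions but empty above `0`. [folklore] -/
theorem not_reduction_of_subsingleton_dims (𝒩 : (n : ℕ) → Set (IntegralRep n))
    (h𝒩 : ∀ n, n ≠ 0 → 𝒩 n = ∅) :
    ¬ ∀ (n : ℕ) (r : IntegralRep n), r.IsRational →
      ∃ (m : ℕ) (N : IntegralRep m), N ∈ 𝒩 m ∧ Equivalent r N := by
  intro h
  refine not_reduction_dimZero (𝒩 0) fun n r hr => ?_
  obtain ⟨m, N, hN, hrN⟩ := h n r hr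
  by_cases hm : m = 0
  · subst hm
    exact ⟨N, hN, hrN⟩
  · rw [h𝒩 m hm] at hN
    exact absurd hN (Set.notMem_empty _)

/-! ## §6 Sanity: each half of `NormalFormPrinciple` alone is trivial -/

/-- Rigidity alone is trivially satisfiable (`𝒩 = ∅`). [folklore] -/
theorem rigid_empty :
    ∀ (n m : ℕ) (N : IntegralRep n) (N' : IntegralRep m), N ∈ (fun _ => (∅ : Set (IntegralRep _))) n →
      N' ∈ (fun _ => (∅ : Set (IntegralRep _))) m → N.value = N'.value → Equivalent N N' :=
  fun _ _ _ _ hN _ _ => absurd hN (Set.notMem_empty _)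

/-- Reduction alone is trivially satisfiable (`𝒩 = rational representations`, reduce by `refl`). [folklore] -/
theorem reducing_rational :
    ∀ (n : ℕ) (r : IntegralRep n), r.IsRational →
      ∃ (m : ℕ) (N : IntegralRep m), N ∈ (fun k => {N : IntegralRep k | N.IsRational}) m ∧ Equivalent r N :=
  fun n r hr => ⟨n, r, hr, Equivalent.refl r⟩

/-- So the content of the crux's conclusion is exactly the CONJUNCTION — and for the rational family the
conjunction is the summit (`nfp_iff_summit`). [folklore] -/
theorem nfp_rational_iff :
    (∀ (n m : ℕ) (N : IntegralRep n) (N' : IntegralRep m), N.IsRational → N'.IsRational →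
      N.value = N'.value → Equivalent N N') ↔ KontsevichZagierPeriods :=
  ⟨fun h _ _ r r' hr hr' hv => h _ _ r r' hr hr' hv, fun h _ _ N N' hN hN' hv => h N N' hN hN' hv⟩

/-! ## §7 Targets (lead's stuck stubs)

None yet: `payload.targets = []` at cycle 1. When a line is picked for this crux (not expected: the
item is declared NOT CLAIMED / do-not-staff), its stubs go here as `theorem <stub>_false : ¬ … := …`.
-/

/-! ## §8 Open questions / near-misses (no `sorry` kept)

* OPEN (= the summit): is `ker KZ.eval = KZ.relations`? Equivalently (this file) `HurwitzSectorComplement`.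
* OPEN (a strengthening we could NOT refute beyond `d = 0`, §5c): is there a reducing family of BOUNDED
  DIMENSION `d ≥ 1`, i.e. do the values of representations of dimension `≤ d` exhaust all periods for
  some `d`? (`piPow k` has dimension `2k`, but `π^k` is also the value of lower-dimensional representations
  with non-constant integrands, e.g. `π² = 6∬ dxdy/(1−xy)` in dimension 2; dimension-1 values contain all
  1-periods of curves (Huber–Wüstholz); a period provably NOT a 1-period would settle `d = 1`.)
* OPEN (the only weapon): a move-invariant `J : FormalRep →+ A` not factoring through `eval`. Must be
  `ℚ`-linear in effect (divisibility), blind to null sets, odd under `f ↦ −f`, invariant under all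
  `ℚ`-semialgebraic injective differentiable reparametrisations with Jacobian, and under fibrewise
  Newton–Leibniz with semialgebraic primitives. Tried this cycle (NOTES.md §Artifact hunt): evaluation in
  other real closed fields (no: values are not first-order, and parameter-free data give the same reals),
  Galois twists (none: coefficients `ℚ`, `Aut(ℝ_alg) = 1`), Euler characteristic / constructible
  invariants (die on null-overlap additivity), dimension / window / positive-part evaluations (die on
  rule 3 / rule 2 / rule 1b respectively), torsion (none: tree theorem). None survives.
-/

end Summit.KontsevichZagierPeriods.KontsevichZagierPeriods.Cruxes.HurwitzSectorComplement.Disproof
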